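import Summits.BirchSwinnertonDyer.BirchSwinnertonDyer.Theorems.EisensteinPrimesMazurMCOnX1RankZeroDeepWitness
import Literature.NumberTheory.EllipticCurves.PAdicHeights
import Literature.NumberTheory.EllipticCurves.RootNumber
import HarnessLib

/-!
# Sign-flip Eisenstein visibility — typed sketch (crux idea seat `bsd-eis-idea` g10, crux 5
`MazurMCOnX1RankZero`, item `stmt-BirchSwinnertonDyer-19035`)

LENS (algebraic side, over `ℚ`, torsion-free end): make `Ш(E')[p]` VISIBLE (Cremona–Mazur) inside
`J₀(N·q)` at ONE auxiliary prime `q ∤ Np` at which the Eisenstein maximal ideal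
`𝔪⁺ = (p, U_q − 1, T_r − 1 − r)` is new ("+1 prime" of Yoo 2019: the `q`-new congruent form `g` has
`a_q(g) = +1`, hence root number `ε(g) = −ε(E)`: the SIGN FLIPS, `L(g,1) = 0`, and Gross–Zagier–Kolyvagin
gives `rank A_g(ℚ) = dim A_g` whenever `L'(g,1) ≠ 0`, with no image hypothesis).  The visible source is
Mordell–Weil of `A_g` (plus the shared torsion line); the output is `p^n ∣ #Ш(E')` for `n` independent
UNOBSTRUCTED lines, which is exactly the cell's deep-witness currency
(`EisensteinPrimesMazurMCOnX1RankZeroDeepWitness.mazurMCOnX1RankZero_of_published_of_deepWitness`).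

What is typed here (no `sorry`, no axiom):
* `SignFlipShadow W p` — the numerical shadow of one raising prime (`q`, primality, `q ≠ p`, `E` good at
  `q`, and the number `n` of unobstructed visible lines it delivers);
* `InjectionLaw` (K2♯ + local K3: the `n` lines inject into `Ш(E')[p]`, i.e. `p^n ∣ #Ш(E')`) and
  `DepthLaw` (global K3, the "Eisenstein Jochnowitz congruence": `q` can be chosen so deep that
  `ord_p #Ш_an(E') ≤ n + (n mod 2)`), as interface laws in the style of `DefiniteSquareLawSketch`;
* `EllipticSignFlipPartner W F p q` — the DIMENSION-ONE shadow of the raising (an elliptic curve `F` of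
  conductor `N·q`, split multiplicative at `q`, same reduction loci away from `q`, `F[p]` reducible,
  positive rank, opposite root number): the object the seat's falsifier F-L1 enumerates in Cremona's table;
* the PROVED door `mazurMCOnX1RankZero_of_signFlipVisibility`: published facts ∧ (at every rank-0 X1 pair
  some isogenous member carries a shadow satisfying both laws) ⟹ the crux BY NAME;
* the digit-two rung `DigitTwoSignFlipVisibility p` (one unobstructed line at the étale end when
  `ord_p #Ш_an = 2`).

FALSIFIER VERDICT recorded with the idea memo (`Ideas/sign-flip-visibility-falsifier.md`): on 230
provably-`Ш[3]`-free θ = 1 control classes (`N ∈ [10⁴, 2·10⁴)`), 39 admit an OPTIMAL elliptic sign-flip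
partner with `F[3] ≃ E[3]` (as Galois modules), matching signs, split `q`, rank 1 and a `q`-UNOBSTRUCTED
generator — so these checkable conditions do NOT imply injection; the information sits in the
scheme-theoretic coincidence `E[p] = F[p]` inside `J₀(Nq)[𝔪⁺]` (K2♯), i.e. in the Eisenstein fine structure
of Ribet's bimodule.  Nothing here is asserted; the laws are hypotheses of the door.
-/

noncomputable section

open scoped Classical

open WeierstrassCurve Literature.NumberTheory.EllipticCurves
  Literature.NumberTheory.EllipticCurves.ModularForms
  Literature.NumberTheory.EllipticCurves.Rank1Residual
  Literature.NumberTheory.EllipticCurves.Greenberg1999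
  Summit.BirchSwinnertonDyer.BirchSwinnertonDyer.Theorems.Rank1ResidualX1Defs
  Summit.BirchSwinnertonDyer.BirchSwinnertonDyer.Theorems.EisensteinPrimesMazurMCOnX1RankZeroDeepWitness
  Summit.BirchSwinnertonDyer.Rank1Residual
  Summit.BirchSwinnertonDyer.Rank1Residual.WAll

set_option linter.dupNamespace false
set_option autoImplicit false

namespace Summit.BirchSwinnertonDyer.BirchSwinnertonDyer.Cruxes.MazurMCOnX1RankZero.SignFlipVisibility

/-- The numerical SHADOW of one sign-flipping Eisenstein level-raising prime for `(E, p)`: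
the prime `q` (`q ≠ p`, `E` good at `q`) and the number `n` of independent visible lines at level
`N·q` that survive every local condition (Mordell–Weil of the `q`-new optimal quotient `A_g`,
`g ≡ f_E (mod 𝔪⁺)`, `a_q(g) = +1`, minus the torsion tax and the tame punctures). Bookkeeping only;
the mathematics is in the two laws below. [cite: Yoo2019TAMS, Thm. 1.3 (arXiv:1409.8342 p. 3)]
[cite: JetchevStein2007, Thm. 5.1.3 (Doc. Math. 12, p. 685)] -/
structure SignFlipShadow (W : WeierstrassCurve ℚ) (p : ℕ) where
  /-- the raising prime -/
  q : ℕ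
  q_prime : q.Prime
  q_ne : q ≠ p
  /-- `E` has good reduction at `q` (`q ∤ N`) -/
  good_at_q : (haveI : Fact q.Prime := ⟨q_prime⟩; W.HasGoodReductionAtPrime q)
  /-- number of independent unobstructed visible lines delivered at level `N·q` -/
  n : ℕ

variable (W : WeierstrassCurve ℚ) [W.IsElliptic] [W.IsGloballyMinimal] (p : ℕ) [Fact p.Prime]

/-- **K2♯ + local K3 (INJECTION LAW).** The `n` unobstructed lines inject into `Ш(E)[p]`
(Cremona–Mazur / Agashe–Stein / Jetchev–Stein visibility at HIGHER level, transplanted to the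
Eisenstein maximal ideal `𝔪⁺`; the decisive clause is the scheme-theoretic coincidence
`E[p] = A_g[𝔭] ∩ E` INSIDE `J₀(Nq)[𝔪⁺]`, see the falsifier verdict). Output in the cell's currency:
`p ^ n ∣ #Ш(E/ℚ)`. Interface law; nothing asserted. [cite: JetchevStein2007, Thm. 5.1.3 and Thm. 5.4.2]
[cite: AgasheStein2005, Thm. 3.1] -/
def InjectionLaw (S : SignFlipShadow W p) : Prop :=
  p ^ S.n ∣ W.shaOrder

/-- **global K3 (DEPTH LAW = "Eisenstein Jochnowitz congruence over ℚ").** The raising prime can be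
chosen so deep that the unobstructed count reaches the analytic `Ш`-depth:
`ord_p #Ш_an(E) ≤ n + (n mod 2)` (the parity term is the Cassels–Tate square). This is where
`L(E,1)/Ω mod p^k` must enter (Bertolini–Darmon's first reciprocity law read at a SPLIT raising prime
through Ribet's exact sequence: the component group `Φ_{J₀(Nq),q}` is the definite Brandt module of
discriminant `q`). Interface law; nothing asserted. [cite: BertoliniDarmon2005, Thm. 4.1]
[cite: Ribet1990, Thm. 4.3] -/
def DepthLaw (S : SignFlipShadow W p) : Prop :=
  ∃ q : ℚ, shaAn W = (q : ℂ) ∧ padicValRat p q ≤ ((S.n + S.n % 2 : ℕ) : ℤ)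

/-- **K1, dimension-one shadow (what F-L1 enumerates).** `F` is an ELLIPTIC sign-flip Eisenstein partner
of `E` at `(p, q)`: `q ≠ p`, `E` good at `q`, `F` SPLIT multiplicative at `q` (`a_q(F) = +1`, Yoo's
"+1 prime"), the same good-reduction and split-multiplicative loci away from `q`, `F[p]` reducible
(so `F[p]^ss ≃ E[p]^ss ≃ 𝟙 ⊕ ω`), a point of infinite order, and OPPOSITE root number.
[cite: Yoo2019TAMS, Thm. 1.2 and Thm. 1.3 (arXiv:1409.8342 p. 3)] -/
def EllipticSignFlipPartner (F : WeierstrassCurve ℚ) [F.IsElliptic] (q : ℕ) [Fact q.Prime] : Prop :=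
  q ≠ p ∧ W.HasGoodReductionAtPrime q ∧ F.HasSplitMultiplicativeReductionAtPrime q ∧
  (∀ (ℓ : ℕ) [Fact ℓ.Prime], ℓ ≠ q → (W.HasGoodReductionAtPrime ℓ ↔ F.HasGoodReductionAtPrime ℓ)) ∧
  (∀ (ℓ : ℕ) [Fact ℓ.Prime], ℓ ≠ q →
    (W.HasSplitMultiplicativeReductionAtPrime ℓ ↔ F.HasSplitMultiplicativeReductionAtPrime ℓ)) ∧
  Red F p ∧ 1 ≤ F.mordellWeilRank ∧ F.rootNumber = -W.rootNumber

omit [W.IsElliptic] [W.IsGloballyMinimal] [Fact p.Prime] in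
/-- Bookkeeping: `n` visible lines certify the deep-witness exponent `k = ⌈n/2⌉`. -/
theorem two_mul_half_ceil (n : ℕ) : 2 * ((n + n % 2) / 2) = n + n % 2 := by omega

/-- **PROVED DOOR.** Granted the eight PUBLISHED facts of the deep-witness line (`hpub`, exactly as in
`mazurMCOnX1RankZero_of_published_of_deepWitness`) and, at every rank-`0` X1 pair, an isogenous member
carrying a sign-flip shadow that satisfies the injection law and the depth law, crux 5
`MazurMCOnX1RankZero` holds (conclusion = the route decl BY NAME). The proof is the deep-witness door with
`k = ⌈n/2⌉`: `p^n ∣ #Ш ⟹ p^(2k−1) ∣ #Ш` and `ord_p #Ш_an ≤ n + n mod 2 = 2k`.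
[cite: Wuthrich2014, Thm. 16 (p. 397) and Prop. 21 (p. 400)] [cite: GreenbergLNM1716, Thm. 4.1] -/
theorem mazurMCOnX1RankZero_of_signFlipVisibility
    (hpub : exists_casselsTate_pairing (K := ℚ) ∧ Wuthrich2014.sha_dvd_analyticSha ∧
      rank_eq_analyticRank_of_analyticRank_le_one ∧ hasEntireLFunction_rat ∧ bsdRHS_eq_of_isIsogenous ∧
      Wuthrich2014.charIdeal_dvd_padicLFunction ∧ greenberg_charValue_rankZero ∧
      nonempty_modularParametrizationData)
    (hvis : ∀ (W : WeierstrassCurve ℚ) [W.IsElliptic] [W.IsGloballyMinimal] (p : ℕ) [Fact p.Prime],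
      ClassX1 W p → W.analyticRank = 0 →
      ∃ (W' : WeierstrassCurve ℚ) (_ : W'.IsElliptic) (_ : W'.IsGloballyMinimal), IsIsogenous W W' ∧
        ∃ S : SignFlipShadow W' p, InjectionLaw W' p S ∧ DepthLaw W' p S) :
    Summit.BirchSwinnertonDyer.BirchSwinnertonDyer.Theses.EisensteinPrimes.MazurMCOnX1RankZero := by
  refine mazurMCOnX1RankZero_of_published_of_deepWitness hpub ?_
  intro W _ _ p _ hX hr0
  obtain ⟨W', i1, i2, hiso, S, hinj, hdepth⟩ := hvis W p hX hr0
  obtain ⟨q, hq, hle⟩ := hdepth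
  refine ⟨W', i1, i2, hiso, q, hq, (S.n + S.n % 2) / 2, ?_, ?_⟩
  · have h2 := two_mul_half_ceil S.n
    push_cast at hle ⊢
    omega
  · have hle' : 2 * ((S.n + S.n % 2) / 2) - 1 ≤ S.n := by omega
    exact (pow_dvd_pow p hle').trans hinj

/-- **First rung (digit two, étale end).** At a rank-`0` X1 pair whose curve carries the rational
`p`-torsion (θ = 1 étale end) and has `ord_p #Ш_an = 2`, ONE unobstructed sign-flip line exists — content:
`p ∣ #Ш(E/ℚ)`, which with the Cassels–Tate square and Wuthrich's upper bound is `BSD(E,p)` there.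
The seat's falsifier F-L1 bears on the dimension-one supply for this rung (2 of 22 deep classes with
`N ≤ 10⁵` have an optimal elliptic candidate at `N·q < 5·10⁵`). Nothing asserted.
[cite: Yoo2019TAMS, Thm. 1.3] [cite: JetchevStein2007, Thm. 5.1.3] -/
def DigitTwoSignFlipVisibility : Prop :=
  ∀ (W : WeierstrassCurve ℚ) [W.IsElliptic] [W.IsGloballyMinimal],
    ClassX1 W p → W.analyticRank = 0 → p ∣ W.torsionOrder →
    (∃ q : ℚ, shaAn W = (q : ℂ) ∧ padicValRat p q = 2) →
    ∃ S : SignFlipShadow W p, S.n = 1 ∧ InjectionLaw W p S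

/-- The rung delivers the deep-witness shape at that pair (bookkeeping: `n = 1`, `k = 1`). -/
theorem deepWitness_shape_of_digitTwo (hD : DigitTwoSignFlipVisibility p)
    (hX : ClassX1 W p) (hr0 : W.analyticRank = 0) (hT : p ∣ W.torsionOrder)
    (h2 : ∃ q : ℚ, shaAn W = (q : ℂ) ∧ padicValRat p q = 2) :
    ∃ q : ℚ, shaAn W = (q : ℂ) ∧ ∃ k : ℕ, padicValRat p q ≤ 2 * k ∧ p ^ (2 * k - 1) ∣ W.shaOrder := by
  obtain ⟨S, hn, hinj⟩ := hD W hX hr0 hT h2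
  obtain ⟨q, hq, hv⟩ := h2
  refine ⟨q, hq, 1, by simp [hv], ?_⟩
  simpa [InjectionLaw, hn] using hinj

end Summit.BirchSwinnertonDyer.BirchSwinnertonDyer.Cruxes.MazurMCOnX1RankZero.SignFlipVisibility

end
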